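import Summits.QuantumFields.YangMills.Theorems.FluctuationComparisonRegPrIntLS2BetaSignedCombKill
import Summits.QuantumFields.YangMills.Theorems.UnitScaleTiltProp7AxialGaugeFace
import HarnessLib

/-!
# THE SIGNED COMB TRANSPORTER vs PRINT'S AXIAL TRANSPORTER: a closed-loop STOKES bound (depth-free), and the (F6) feed for an axially ALIGNED pair

Crux `stmt-QuantumFields-20520` (`…Theses.UnitScaleTilt.FluctuationComparisonRegPrIntL`), LINE g18-1 S2β, organ (C3) ∕ DET-REP (B) (Q-TUBE) ∕ CLOSE-BOND-MIN;
cell `ym3-torus` (HUMAN RULING D-0037 — rung R3, not Clay), width seat `ym3-torus-px21` g17; count-neutral helper (`--kind proof --supports stmt-QuantumFields-20520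
--as helper`).  Theorems only: 0 `def`, 0 `instance`, 0 `notation`, 0 `sorry`.
WHY.  The cover row (F6) of this seat's chain ✓`…TubularChartDockLocalWinId` tests the comb coordinate of a fine field `W` RELATIVE to the base `U₀`,
`(T₀(b₋) U₀ b T₀(b₊)⁻¹)⁻¹ · (T_W(b₋) W b T_W(b₊)⁻¹)` with `T = combTransporter k` (the SIGNED comb ✓`…S2BetaSignedComb`: axes in the order `0, 1, …, d−1`, steps by
`.val` differences from the block centre `rootOf k x`), while print's aligner and sup bounds (✓`Prop7AxialGauge.exists_axialGauge_T3`, ✓`Prop7AxialGaugeBlock.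
dist1_mul_inv_le_interior`, ✓`Prop7AxialGaugeFace.dist1_mul_inv_le_face_T3`) speak lit `B10Eq27TorusAxialLog.axialT W y x = W(Γ_{y,x})` (B5's tree contour: axes in
the order `d−1, …, 0`, steps by `valMinAbs`).  The two transporters are NOT equal (different staircases), but they differ by the holonomy of a CLOSED word of
length `≤ d(Lᵏ−1)` inside the block, so by the crude non-abelian Stokes bound (lit ✓`LatticeWordStokes.dist1_holAt_le`) they agree up to
`(d(Lᵏ−1))²∕4 · δ` — DEPTH-FREE (`≤ (d²∕4)·e`) at the regular radius `δ = e·L^{−2k}`.  Consequence (§3): for an axially ALIGNED pair (`axialT W y x = axialT U₀ y x`)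
the (F6) test quantity is within `dist1(W b U₀ b⁻¹) + 2·(d(Lᵏ−1))²∕4·(δ_W + δ₀)` of `1` on EVERY bond — no comb-length factor (ymfull-r3-prover-4 g0's knit
✓`…SignedCombSupLipschitz.slice_of_bondwiseClose` pays `(2·d·(Lᵏ−1)∕2 + 1)·M`, which the O(ε₀) face bound cannot afford).
WHAT.  §1 dictionary `lineHol ∕ lineHolBack ∕ lineHolZ ∕ pathHolZ = holAt ∘ walk` of lit `BlockAveraging.axisRun ∕ stairRuns`; the signed offsets from the
centre ARE print's relative position (`rel (rootOf k x) x ν = (x ν).val − (rootOf k x ν).val`, ✓`val_rootOf`); §2 ★★ `dist1_axialT_mul_inv_combTransporter_le`;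
§3 ★★★ `dist1_combCoordRel_le_of_axialT_eq` (+ `rootOf_eq_embIter_iterBlockOf`, the spelling bridge to Prop7's `embIter k (iterBlockOf k x)`).
HONEST SCOPE.  Lattice-word bookkeeping + one application of the landed Stokes bound; nothing of CLOSE-BOND-MIN ∕ (Q-TUBE) ∕ DET-REP (B) ∕ 20520 is proved;
rung R3 = SU(2) YM₃ on T³ — NOT d = 4, NOT infinite volume, NOT a mass gap, NOT Clay.
[cite: Balaban1985Averaging, (8)-(9) pp.18-19, pp.24-25; Balaban1985RegularSpaces, Lemma 1 (1.24)-(1.26) pp.79-80; Balaban1984PropagatorsI, (1.7) p.18]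
-/

noncomputable section

namespace Summit.QuantumFields.YangMills.Theorems.FluctuationComparisonRegPrIntLS2BetaCombTransporterAxialT

open Literature.MathematicalPhysics.QuantumFieldTheory.Balaban1983to89
open T4Continuum
open T4ReflectionCone (netDisp_append netDisp_replicate)
open B10Eq27TorusAxialLog (axialT rel rel_apply holT holT_eq_holAt)
open B7Prop1Explicit (treeWord seg l1 length_treeWord)
open B5Eq118OneStroke (iterBlockOf)
open B15DeterminingSets (embIter)
open T4RootedResidualGauge (rootOf lineHol shiftN)
open LatticeWordStokes (dist1_holAt_le)
open Summit.QuantumFields.YangMills.Theorems.FluctuationComparisonRegPrIntLS2BetaSignedComb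
open Summit.QuantumFields.YangMills.Theorems.FluctuationComparisonRegPrIntLS2BetaSignedCombKill (val_rootOf val_rootOf_le)
open Summit.QuantumFields.YangMills.Theorems.Prop7AxialGaugeFace (disp_apply_eq_netDisp netDisp_treeWord walkEnd_treeWord_rel)

variable {P : Params} {j : ℕ} {G : Type*} [GaugeGroup G]

/-! ## §1  The signed straight and staircase holonomies as holonomies of lattice words -/

/-- A forward run from `a` ends at `a + m·e_μ`. [folklore] -/
theorem walkEnd_replicate_true (a : Site P j) (μ : Fin P.d) (m : ℕ) :
    walkEnd a (List.replicate m (μ, true)) = shiftZ a μ (m : ℤ) := by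
  funext ν
  rw [walkEnd_apply, netDisp_replicate]
  by_cases h : ν = μ
  · subst h; simp [shiftZ_apply_self]
  · rw [shiftZ_apply_of_ne a h]; simp [Ne.symm h]

/-- A backward run from `a` ends at `a − m·e_μ`. [folklore] -/
theorem walkEnd_replicate_false (a : Site P j) (μ : Fin P.d) (m : ℕ) :
    walkEnd a (List.replicate m (μ, false)) = shiftZ a μ (-(m : ℤ)) := by
  funext ν
  rw [walkEnd_apply, netDisp_replicate]
  by_cases h : ν = μ
  · subst h; simp [shiftZ_apply_self]
  · rw [shiftZ_apply_of_ne a h]; simp [Ne.symm h]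

/-- The forward straight holonomy IS the holonomy of the forward run. [cite: Balaban1985Averaging, (9) p.18] -/
theorem lineHol_eq_holAt (U : GaugeField P j G) (a : Site P j) (μ : Fin P.d) :
    ∀ m : ℕ, lineHol U a μ m = holAt U (walk a (List.replicate m (μ, true)))
  | 0 => by simp [lineHol, walk, holAt_nil]
  | m + 1 => by
    rw [lineHol, lineHol_eq_holAt U a μ m, List.replicate_succ', walk_append, holAt_append, walkEnd_replicate_true, shiftZ_natCast]
    simp [walk, holAt_cons, holAt_nil]

/-- The backward straight holonomy IS the holonomy of the backward run. [cite: Balaban1985Averaging, (9) p.18] -/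
theorem lineHolBack_eq_holAt (U : GaugeField P j G) (a : Site P j) (μ : Fin P.d) :
    ∀ m : ℕ, lineHolBack U a μ m = holAt U (walk a (List.replicate m (μ, false)))
  | 0 => by simp [walk, holAt_nil]
  | m + 1 => by
    rw [lineHolBack_succ, lineHolBack_eq_holAt U a μ m, List.replicate_succ', walk_append, holAt_append, walkEnd_replicate_false]
    have hun : (shiftZ a μ (-(m : ℤ))).unshift μ = shiftZ a μ (-((m : ℤ) + 1)) := by
      funext ν
      by_cases h : ν = μ
      · subst h; simp [Site.unshift, shiftZ_apply_self]; ring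
      · simp [Site.unshift, Function.update_of_ne h, shiftZ_apply_of_ne a h]
    simp [walk, holAt_cons, holAt_nil, hun]

/-- The signed straight holonomy IS the holonomy of lit `axisRun μ z` (the run of `|z|` letters `sign(z)·e_μ`). [cite: Balaban1987RG1, (0.3) p.252] -/
theorem lineHolZ_eq_holAt_axisRun (U : GaugeField P j G) (a : Site P j) (μ : Fin P.d) (z : ℤ) :
    lineHolZ U a μ z = holAt U (walk a (axisRun μ z)) := by
  cases z with
  | ofNat m =>
    rw [show (Int.ofNat m : ℤ) = (m : ℤ) from rfl, lineHolZ_natCast, lineHol_eq_holAt]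
    simp [axisRun]
  | negSucc m =>
    rw [lineHolZ_negSucc, lineHolBack_eq_holAt]
    have : axisRun μ (Int.negSucc m) = List.replicate (m + 1) (μ, false) := by
      simp [axisRun, Int.natAbs_negSucc]
    rw [this]

/-- The end of a signed run. [folklore] -/
theorem walkEnd_axisRun (a : Site P j) (μ : Fin P.d) (z : ℤ) : walkEnd a (axisRun μ z) = shiftZ a μ z := by
  cases z with
  | ofNat m => simp [axisRun, walkEnd_replicate_true]
  | negSucc m =>
    have : axisRun μ (Int.negSucc m) = List.replicate (m + 1) (μ, false) := by simp [axisRun, Int.natAbs_negSucc]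
    rw [this, walkEnd_replicate_false, Int.negSucc_eq]; push_cast; ring_nf

/-- ★ **THE SIGNED STAIRCASE HOLONOMY IS THE HOLONOMY OF THE STAIRCASE WORD**: through a duplicate-free list of axes `l`, `pathHolZ U a x l` is the holonomy from
`a` of lit `stairRuns n l` with the offsets `n ν = (x ν).val − (a ν).val` read ONCE at the start (later axes see the same offsets because the list has no repeats).
[cite: Balaban1987RG1, (0.3) p.252; Balaban1985Averaging, (9) p.18] -/
theorem pathHolZ_eq_holAt_stairRuns (U : GaugeField P j G) (x : Site P j) :
    ∀ (l : List (Fin P.d)), l.Nodup → ∀ (a : Site P j) (n : Fin P.d → ℤ),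
      (∀ ν ∈ l, (((x ν).val : ℤ) - ((a ν).val : ℤ)) = n ν) → pathHolZ U a x l = holAt U (walk a (stairRuns n l))
  | [], _, a, n, _ => by simp [pathHolZ, stairRuns, walk, holAt_nil]
  | μ :: l, hl, a, n, hn => by
    rw [List.nodup_cons] at hl
    have hμ : (((x μ).val : ℤ) - ((a μ).val : ℤ)) = n μ := hn μ (by simp)
    rw [pathHolZ, stairRuns, walk_append, holAt_append, walkEnd_axisRun, hμ, lineHolZ_eq_holAt_axisRun,
      pathHolZ_eq_holAt_stairRuns U x l hl.2 (shiftZ a μ (n μ)) n (fun ν hν => by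
        have hne : ν ≠ μ := fun h => hl.1 (h ▸ hν)
        rw [shiftZ_apply_of_ne a hne]; exact hn ν (List.mem_cons_of_mem μ hν))]

/-- The end of the staircase through all axes is the target. [folklore] -/
theorem walkEnd_stairRuns_finRange (x a : Site P j) (n : Fin P.d → ℤ) (hn : ∀ ν, (((x ν).val : ℤ) - ((a ν).val : ℤ)) = n ν) :
    walkEnd a (stairRuns n (List.finRange P.d)) = x := by
  funext ν
  rw [walkEnd_apply, netDisp_stairRuns n _ (List.nodup_finRange P.d), if_pos (List.mem_finRange ν), ← hn ν, Int.cast_sub,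
    Int.cast_natCast, Int.cast_natCast, ZMod.natCast_zmod_val, ZMod.natCast_zmod_val, add_sub_cancel]

/-! ## §2  The signed comb transporter vs the axial transporter: a closed word in the block, and the Stokes bound -/

section Stokes

variable {k : ℕ}

/-- **THE SIGNED OFFSETS FROM THE BLOCK CENTRE ARE PRINT'S RELATIVE POSITION**: `rel (rootOf k x) x ν = (x ν).val − (rootOf k x ν).val` — no wrap-around, because
`|x_ν − y_ν| ≤ (Lᵏ−1)∕2 < N∕2` (✓`val_rootOf`). [cite: Balaban1984PropagatorsI, (1.6)-(1.7) p.18] -/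
theorem rel_rootOf_eq (hk : k ≤ P.m + P.K) (x : Site P 0) (ν : Fin P.d) :
    rel (rootOf k x) x ν = ((x ν).val : ℤ) - ((rootOf k x ν).val : ℤ) := by
  set N := P.sitesPerDir 0 with hN
  have hNpos : 0 < P.L ^ k := pow_pos P.L_pos k
  have hN2 : 2 * P.L ^ k ≤ N := by
    rw [hN, Summit.QuantumFields.YangMills.Theorems.Prop7FlatHolonomy.sitesPerDir_zero_eq_mul_pow hk]
    exact Nat.mul_le_mul_right _ (P.one_lt_sitesPerDir k)
  have hv := val_rootOf hk x ν
  obtain ⟨hle1, hle2⟩ := val_rootOf_le hk x ν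
  rw [rel_apply]
  apply (ZMod.valMinAbs_spec _ _).mpr
  constructor
  · rw [Int.cast_sub, Int.cast_natCast, Int.cast_natCast, ZMod.natCast_zmod_val, ZMod.natCast_zmod_val]
  · have h1 : (((rootOf k x ν).val : ℕ) : ℤ) ≤ ((x ν).val : ℤ) + (((P.L ^ k - 1) / 2 : ℕ) : ℤ) := by exact_mod_cast hle1
    have h2 : (((x ν).val : ℕ) : ℤ) ≤ ((rootOf k x ν).val : ℤ) + (((P.L ^ k - 1) / 2 : ℕ) : ℤ) := by exact_mod_cast hle2
    have h3 : 2 * ((((P.L ^ k - 1) / 2 : ℕ) : ℤ)) + 1 ≤ ((P.L ^ k : ℕ) : ℤ) := by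
      have : 2 * ((P.L ^ k - 1) / 2) + 1 ≤ P.L ^ k := by omega
      exact_mod_cast this
    have h4 : 2 * ((P.L ^ k : ℕ) : ℤ) ≤ (N : ℤ) := by exact_mod_cast hN2
    constructor <;> linarith

/-- **`rootOf k x = embIter k (iterBlockOf k x)`** — the spelling bridge between this lineage's `rootOf` (lit `T4RootedResidualGauge`, via `B14.Eq22Determines.blockIter`)
and Prop7's block centre (lit `B5Eq118OneStroke.iterBlockOf`); the two iterated block maps agree by their defining recursions. [cite: Balaban1987RG1, (0.1) p.251] -/
theorem rootOf_eq_embIter_iterBlockOf (k : ℕ) (x : Site P 0) : rootOf k x = embIter k (iterBlockOf k x) := by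
  have h : ∀ j : ℕ, B14.Eq22Determines.blockIter j x = iterBlockOf j x := by
    intro j
    induction j with
    | zero => rfl
    | succ j ih => rw [B14.Eq22Determines.blockIter_succ, B5Eq118OneStroke.iterBlockOf_succ, ih]
  show embIter k (B14.Eq22Determines.blockIter k x) = _
  rw [h]

/-- ★★ **THE SIGNED COMB TRANSPORTER AND THE AXIAL TRANSPORTER AGREE UP TO A DEPTH-FREE STOKES ERROR.**  If every plaquette variable of `U` is within `δ ≥ 0` of `1`,
then for every fine site `x` with block centre `y = rootOf k x`:  `dist1(axialT U y x · (combTransporter k U x)⁻¹) ≤ (d(Lᵏ−1))²∕4 · δ`.  Mechanism: both are holonomies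
of staircases from `y` to `x` with the same offsets `n_ν = x_ν − y_ν` (`|n_ν| ≤ (Lᵏ−1)∕2`) — B5's tree contour (axes `d−1, …, 0`) and the signed comb (axes
`0, …, d−1`) — so `axialT · comb⁻¹` is the holonomy of a CLOSED word of length `2|n|₁ ≤ d(Lᵏ−1)`, bounded by lit ✓`LatticeWordStokes.dist1_holAt_le`.  At the regular
radius `δ = e·L^{−2k}` the bound is `≤ (d²∕4)·e`, uniformly in `k`. [cite: Balaban1985Averaging, (9) p.19, (19)-(20) p.21, pp.24-25; Balaban1985RegularSpaces, (1.19) p.77] -/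
theorem dist1_axialT_mul_inv_combTransporter_le (hk : k ≤ P.m + P.K) (U : GaugeField P 0 G) {δ : ℝ} (hδ : 0 ≤ δ)
    (hU : PlaqSmall δ U) (x : Site P 0) :
    dist1 (axialT U (rootOf k x) x * (combTransporter k U x)⁻¹) ≤ ((((P.d * (P.L ^ k - 1) : ℕ) : ℝ)) ^ 2 / 4) * δ := by
  set y := rootOf k x with hy
  set n : Fin P.d → ℤ := fun ν => ((x ν).val : ℤ) - ((y ν).val : ℤ) with hn
  set W := stairRuns n (List.finRange P.d) with hW
  have hrel : rel y x = n := funext fun ν => rel_rootOf_eq hk x ν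
  have hT : combTransporter k U x = holAt U (walk y W) :=
    pathHolZ_eq_holAt_stairRuns U x _ (List.nodup_finRange _) y n (fun ν _ => rfl)
  have hA : axialT U y x = holAt U (walk y (treeWord n)) := by
    show holT U y (treeWord (rel y x)) = _
    rw [hrel, holT_eq_holAt]
  have hAend : walkEnd y (treeWord n) = x := by rw [← hrel]; exact walkEnd_treeWord_rel y x
  have hWend : walkEnd y W = x := walkEnd_stairRuns_finRange x y n (fun ν => rfl)
  -- the closed word
  have hloop : axialT U y x * (combTransporter k U x)⁻¹ = holAt U (walk y (treeWord n ++ wordRev W)) := by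
    have h1 : holAt U (walk x (wordRev W)) = (holAt U (walk y W))⁻¹ := by
      have := holAt_walk_wordRev U y W
      rwa [hWend] at this
    rw [walk_append, holAt_append, hAend, h1, hA, hT]
  -- zero net displacement
  have hnull : ∀ ν, netDisp (treeWord n ++ wordRev W) ν = 0 := by
    intro ν
    rw [netDisp_append, netDisp_wordRev, hW, netDisp_stairRuns n _ (List.nodup_finRange _), if_pos (List.mem_finRange ν), netDisp_treeWord]
    ring
  -- length
  have hlenW : ∀ l : List (Fin P.d), (stairRuns n l).length = (l.map fun a => (n a).natAbs).sum := by
    intro l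
    induction l with
    | nil => rfl
    | cons a l ih => rw [stairRuns, List.length_append, ih, List.map_cons, List.sum_cons]; simp [axisRun]
  have hl1 : W.length = l1 n := by
    rw [hW, hlenW, B7Prop1Explicit.l1, Fin.sum_univ_def]
  have hlen : (treeWord n ++ wordRev W).length = 2 * l1 n := by
    rw [List.length_append, length_treeWord]
    simp only [wordRev, List.length_reverse, List.length_map]
    rw [hl1]; ring
  have hl1le : l1 n ≤ P.d * ((P.L ^ k - 1) / 2) := by
    have hb : ∀ ν, (n ν).natAbs ≤ (P.L ^ k - 1) / 2 := by
      intro ν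
      obtain ⟨h1, h2⟩ := val_rootOf_le hk x ν
      rw [← hy] at h1 h2
      simp only [hn]
      omega
    calc l1 n = ∑ ν, (n ν).natAbs := rfl
      _ ≤ ∑ _ν : Fin P.d, (P.L ^ k - 1) / 2 := Finset.sum_le_sum fun ν _ => hb ν
      _ = P.d * ((P.L ^ k - 1) / 2) := by rw [Finset.sum_const, Finset.card_univ, Fintype.card_fin, smul_eq_mul]
  have hlen' : ((treeWord n ++ wordRev W).length : ℝ) ≤ ((P.d * (P.L ^ k - 1) : ℕ) : ℝ) := by
    have h : (treeWord n ++ wordRev W).length ≤ P.d * (P.L ^ k - 1) := by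
      rw [hlen]
      calc 2 * l1 n ≤ 2 * (P.d * ((P.L ^ k - 1) / 2)) := Nat.mul_le_mul_left _ hl1le
        _ = P.d * (2 * ((P.L ^ k - 1) / 2)) := by ring
        _ ≤ P.d * (P.L ^ k - 1) := Nat.mul_le_mul_left _ (by omega)
    exact_mod_cast h
  -- Stokes
  rw [hloop]
  refine (dist1_holAt_le U hδ hU _ hnull y).trans ?_
  have h0 : (0 : ℝ) ≤ ((treeWord n ++ wordRev W).length : ℝ) := by positivity
  have hsq := pow_le_pow_left₀ h0 hlen' 2
  exact mul_le_mul_of_nonneg_right (by linarith) hδ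

end Stokes

/-! ## §3  The (F6) feed for an axially ALIGNED pair: the relative comb coordinate is bondwise-close, with no comb-length factor -/

section Aligned

variable {k : ℕ}

/-- Group algebra: `dist1(a⁻¹ b) ≤ dist1(c a⁻¹) + dist1(c b⁻¹)` (insert `c⁻¹ c`). [folklore] -/
theorem dist1_inv_mul_le_of_common {G : Type*} [GaugeGroup G] (a b c : G) :
    dist1 (a⁻¹ * b) ≤ dist1 (c * a⁻¹) + dist1 (c * b⁻¹) := by
  have h1 : dist1 (a⁻¹ * c) = dist1 (c * a⁻¹) := by
    rw [show a⁻¹ * c = a⁻¹ * (c * a⁻¹) * a⁻¹⁻¹ by group, GaugeGroup.dist1_conj]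
  have h2 : dist1 (c⁻¹ * b) = dist1 (c * b⁻¹) := by
    rw [show c⁻¹ * b = b⁻¹ * (c * b⁻¹)⁻¹ * b⁻¹⁻¹ by group, GaugeGroup.dist1_conj, GaugeGroup.dist1_inv]
  calc dist1 (a⁻¹ * b) = dist1 ((a⁻¹ * c) * (c⁻¹ * b)) := by congr 1; group
    _ ≤ dist1 (a⁻¹ * c) + dist1 (c⁻¹ * b) := GaugeGroup.dist1_mul_le _ _
    _ = dist1 (c * a⁻¹) + dist1 (c * b⁻¹) := by rw [h1, h2]

/-- ★★★ **THE (F6) FEED FOR AN ALIGNED PAIR.**  `W`, `U₀` with plaquette variables within `δ_W`, `δ₀` of `1`, and `W` in the complete `k`-fold axial gauge RELATIVE to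
`U₀` in print's currency (`axialT W y x = axialT U₀ y x` at every fine `x`, `y = rootOf k x` its block centre — ✓`Prop7AxialGauge.exists_axialGauge_T3` after
`rootOf_eq_embIter_iterBlockOf`).  Then on EVERY bond `b` the comb coordinate of `W` relative to `U₀` — the quantity the cover row (F6) of
✓`…TubularChartDockLocalWinId.exists_tubularHaarChart_pivotAct_local_winId` tests against the window `Θ(B(0, s∕2))` — satisfies
`dist1((T₀(b₋) U₀ b T₀(b₊)⁻¹)⁻¹ · (T_W(b₋) W b T_W(b₊)⁻¹)) ≤ dist1(W b · U₀ b⁻¹) + 2·((d(Lᵏ−1))²∕4)·(δ_W + δ₀)`, `T = combTransporter k`: BONDWISE closeness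
suffices, with NO comb-length factor (the signed and axial transporters of each field differ by the §2 Stokes error only, and the axial ones coincide).
At the regular radii `δ = e·L^{−2k}`: `+ (d²∕2)·(e_W + e₀)`, uniformly in `k`. [cite: Balaban1985RegularSpaces, Lemma 1 (1.24)-(1.26) pp.79-80; Balaban1985Averaging, pp.24-25] -/
theorem dist1_combCoordRel_le_of_axialT_eq (hk : k ≤ P.m + P.K) (W U₀ : GaugeField P 0 G) {δW δ₀ : ℝ} (hδW : 0 ≤ δW) (hδ₀ : 0 ≤ δ₀)
    (hW : PlaqSmall δW W) (hU₀ : PlaqSmall δ₀ U₀)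
    (hax : ∀ x : Site P 0, axialT W (rootOf k x) x = axialT U₀ (rootOf k x) x) (b : PBond P 0) :
    dist1 ((combTransporter k U₀ b.src * U₀ b * (combTransporter k U₀ b.tgt)⁻¹)⁻¹ *
        (combTransporter k W b.src * W b * (combTransporter k W b.tgt)⁻¹)) ≤
      dist1 (W b * (U₀ b)⁻¹) + 2 * (((((P.d * (P.L ^ k - 1) : ℕ) : ℝ)) ^ 2 / 4) * (δW + δ₀)) := by
  set C : ℝ := ((((P.d * (P.L ^ k - 1) : ℕ) : ℝ)) ^ 2 / 4) with hC
  set T₀s := combTransporter k U₀ b.src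
  set T₀t := combTransporter k U₀ b.tgt
  set TWs := combTransporter k W b.src
  set TWt := combTransporter k W b.tgt
  -- the transporters of the two fields at one site are close: both are Stokes-close to the common axial transporter
  have hsite : ∀ x : Site P 0, dist1 ((combTransporter k U₀ x)⁻¹ * combTransporter k W x) ≤ C * δ₀ + C * δW := by
    intro x
    refine (dist1_inv_mul_le_of_common _ _ (axialT U₀ (rootOf k x) x)).trans (add_le_add ?_ ?_)
    · exact dist1_axialT_mul_inv_combTransporter_le hk U₀ hδ₀ hU₀ x
    · rw [← hax x]; exact dist1_axialT_mul_inv_combTransporter_le hk W hδW hW x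
  have hs := hsite b.src
  have ht : dist1 (TWt⁻¹ * T₀t) ≤ C * δ₀ + C * δW := by
    have h := hsite b.tgt
    rwa [← GaugeGroup.dist1_inv, mul_inv_rev, inv_inv] at h
  -- conjugate by `T₀(b₊)`: the test quantity is `T₀t · X · T₀t⁻¹`, `X = (U₀ b⁻¹ · (T₀s⁻¹ TWs) · U₀ b) · (U₀ b⁻¹ W b) · (TWt⁻¹ T₀t)`
  have hconj : (T₀s * U₀ b * T₀t⁻¹)⁻¹ * (TWs * W b * TWt⁻¹) =
      T₀t * (((U₀ b)⁻¹ * (T₀s⁻¹ * TWs) * (U₀ b)) * ((U₀ b)⁻¹ * W b) * (TWt⁻¹ * T₀t)) * T₀t⁻¹ := by group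
  rw [hconj, GaugeGroup.dist1_conj]
  have h1 : dist1 ((U₀ b)⁻¹ * (T₀s⁻¹ * TWs) * (U₀ b)) = dist1 (T₀s⁻¹ * TWs) := by
    rw [show (U₀ b)⁻¹ * (T₀s⁻¹ * TWs) * U₀ b = (U₀ b)⁻¹ * (T₀s⁻¹ * TWs) * (U₀ b)⁻¹⁻¹ by rw [inv_inv], GaugeGroup.dist1_conj]
  have h2 : dist1 ((U₀ b)⁻¹ * W b) = dist1 (W b * (U₀ b)⁻¹) := by
    rw [show (U₀ b)⁻¹ * W b = (U₀ b)⁻¹ * (W b * (U₀ b)⁻¹) * (U₀ b)⁻¹⁻¹ by group, GaugeGroup.dist1_conj]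
  calc dist1 ((U₀ b)⁻¹ * (T₀s⁻¹ * TWs) * U₀ b * ((U₀ b)⁻¹ * W b) * (TWt⁻¹ * T₀t))
      ≤ dist1 ((U₀ b)⁻¹ * (T₀s⁻¹ * TWs) * U₀ b * ((U₀ b)⁻¹ * W b)) + dist1 (TWt⁻¹ * T₀t) := GaugeGroup.dist1_mul_le _ _
    _ ≤ dist1 ((U₀ b)⁻¹ * (T₀s⁻¹ * TWs) * U₀ b) + dist1 ((U₀ b)⁻¹ * W b) + dist1 (TWt⁻¹ * T₀t) :=
        add_le_add (GaugeGroup.dist1_mul_le _ _) le_rfl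
    _ = dist1 (T₀s⁻¹ * TWs) + dist1 (W b * (U₀ b)⁻¹) + dist1 (TWt⁻¹ * T₀t) := by rw [h1, h2]
    _ ≤ (C * δ₀ + C * δW) + dist1 (W b * (U₀ b)⁻¹) + (C * δ₀ + C * δW) := by linarith
    _ = dist1 (W b * (U₀ b)⁻¹) + 2 * (C * (δW + δ₀)) := by ring

end Aligned

end Summit.QuantumFields.YangMills.Theorems.FluctuationComparisonRegPrIntLS2BetaCombTransporterAxialT

end
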